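import Summits.CriticalPhenomena.PercolationContinuityZ3.Theorems.PercNearOneGluingNoHeavyLowerTailKNGoodThreeRelaysBorrowCells
import Summits.CriticalPhenomena.PercolationContinuityZ3.Theorems.PercNearOneGluingNoHeavyLowerTailKNGoodThreeRelaysBorrowArith
import HarnessLib

/-!
# `NoHeavyLowerTail` (stmt-CriticalPhenomena-4575) — THEOREM C: strong goodness for three relays beyond Kozma–Nitzan's
# Theorem-2 hypothesis (the "borrowing" certificate), event level

Support file (`--supports stmt-CriticalPhenomena-4575`, hull-port prover `prim-hp-2`, gen 25).  No new definitions, no named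
facts, no sorries; standard axioms.  `KNGoodThreeKN.core` (gen 23) lifts Kozma–Nitzan's Theorem 2 (arXiv:2401.12397, p. 8) to
pocket-augmented events under their hypothesis `m_c ≤ m_{at}`.  Here that hypothesis is weakened to
`m_c ≤ m_{at} + β·P(W3) + γ·P(W4)` for parameters `β, γ ≥ 0`, `β + γ ≤ 1` with `β·P(W14) ≤ P(a↔b) − P(c↔b)`,
`γ·P(W12) ≤ P(t↔b) − P(c↔b)` (worlds `W3 = ab|c|t`, `W4 = tb|a|c`, `W14 = ab|tc`, `W12 = ac|tb`): the hub deficit is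
BORROWED from the single-relay worlds.  Proof = Kozma–Nitzan's `I + II + III` with ten pocket-augmented BHK rows (the six of
`core`, two more hub rows with test events `{a↔b}`, `{t↔b}`, two more sink rows with sink events `{t↔b}`, `{a↔b}`) plus pocket
superadditivity; prim-hp-2 MEMO-gen25 §1.  `β = γ = 0` is `KNGoodThreeKN.core`.
[cite: KozmaNitzan2024, Thm. 2 (p. 8), Lemma 1–2 (pp. 5–6), §3.2 Definition (p. 12)]
[cite: VandenbergHaggstromKahn2005, Thm. 1.1 (pp. 3–5), Remark 1 (p. 5)]
-/

noncomputable section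

namespace Summit.CriticalPhenomena.PercolationContinuityZ3.Theorems

open MeasureTheory Set Literature.Probability.LatticeModels Literature.Probability.Percolation
open scoped Classical

namespace KNGoodThreeKN

open KNGoodPocketBHK

variable {V : Type*} [Fintype V]

set_option maxHeartbeats 1600000 in
/-- **THEOREM C (event level): the borrowing certificate.**  `o, b` vertices, relays `a, t, c`; `𝒬_a, 𝒬_t` disjoint families
of vertex sets missing `a, t, c`; `c` the least reliable relay (`P(c↔b) ≤ P(a↔b)`, `P(c↔b) ≤ P(t↔b)`); `β, γ ≥ 0`, `β + γ ≤ 1`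
with `β·P(a↔b, a↮t, t↔c) ≤ P(a↔b) − P(c↔b)`, `γ·P(t↔b, a↮t, a↔c) ≤ P(t↔b) − P(c↔b)` and
`P(c↔b, a↮b, t↮b) ≤ P(a↔b, t↔b, c↮b) + β·P(a↔b, a↮t, {a,t}↮c) + γ·P(t↔b, a↮t, {a,t}↮c)`.  Then
`μ(c↔b, o↮b, o↔{a,t}) + μ(C(o)∈𝒬_a, c↔b, a↮b) + μ(C(o)∈𝒬_t, c↔b, t↮b)`
`≤ μ(o↔b, c↮b, o↔{a,t}) + μ(C(o)∈𝒬_a, a↔b, c↮b) + μ(C(o)∈𝒬_t, t↔b, c↮b)`.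
[cite: KozmaNitzan2024, Thm. 2 (p. 8), Lemma 2 (p. 6)] [cite: VandenbergHaggstromKahn2005, Thm. 1.1 (pp. 3–5)] -/
theorem core_borrow (w : Sym2 V → unitInterval) (o b a t c : V) (Qa Qt : Set (Set V))
    (hQa : ∀ W ∈ Qa, a ∉ W ∧ t ∉ W ∧ c ∉ W) (hQt : ∀ W ∈ Qt, a ∉ W ∧ t ∉ W ∧ c ∉ W) (hdis : Disjoint Qa Qt)
    (hca : (prodBernoulli w).real (openConn c b) ≤ (prodBernoulli w).real (openConn a b))
    (hct : (prodBernoulli w).real (openConn c b) ≤ (prodBernoulli w).real (openConn t b))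
    (β γ : ℝ) (hβ0 : 0 ≤ β) (hγ0 : 0 ≤ γ) (hβγ : β + γ ≤ 1)
    (hβ : β * (prodBernoulli w).real (openConn a b ∩ (openConn a t)ᶜ ∩ openConn t c) ≤
      (prodBernoulli w).real (openConn a b) - (prodBernoulli w).real (openConn c b))
    (hγ : γ * (prodBernoulli w).real (openConn t b ∩ (openConn a t)ᶜ ∩ openConn a c) ≤
      (prodBernoulli w).real (openConn t b) - (prodBernoulli w).real (openConn c b))
    (hX : (prodBernoulli w).real (openConn c b ∩ (openConn a b)ᶜ ∩ (openConn t b)ᶜ) ≤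
      (prodBernoulli w).real (openConn a b ∩ openConn t b ∩ (openConn c b)ᶜ) +
        β * (prodBernoulli w).real (openConn a b ∩ (openConn a t)ᶜ ∩ avoidSet ({a, t} : Set V) {c}) +
        γ * (prodBernoulli w).real (openConn t b ∩ (openConn a t)ᶜ ∩ avoidSet ({a, t} : Set V) {c})) :
    (prodBernoulli w).real (openConn c b ∩ (openConn o b)ᶜ ∩ (openConn o a ∪ openConn o t)) +
        (prodBernoulli w).real (pk o Qa ∩ (openConn c b ∩ (openConn a b)ᶜ)) +
        (prodBernoulli w).real (pk o Qt ∩ (openConn c b ∩ (openConn t b)ᶜ)) ≤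
      (prodBernoulli w).real (openConn o b ∩ (openConn c b)ᶜ ∩ (openConn o a ∪ openConn o t)) +
        (prodBernoulli w).real (pk o Qa ∩ (openConn a b ∩ (openConn c b)ᶜ)) +
        (prodBernoulli w).real (pk o Qt ∩ (openConn t b ∩ (openConn c b)ᶜ)) := by
  classical
  set μ := prodBernoulli w with hμ
  haveI : IsProbabilityMeasure μ := by rw [hμ]; infer_instance
  have hmeas : ∀ A : Set (BondConfig V), MeasurableSet A := fun _ => MeasurableSet.of_discrete
  have eL := real_lhs_eq w o b a t c Qa Qt hQa hQt hdis
  have eR := real_rhs_eq w o b a t c Qa Qt hQa hQt hdis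
  have Ma := real_cb_split_a w a t c b
  have Mb := real_ab_split w a t c b
  have Mc := real_cb_split_t w a t c b
  have Md := real_tb_split w a t c b
  have MKN1 := mc_set_eq w a t c b
  have MKN2 := mK_set_eq w a t c b
  ---------------------------------------------------------------- events
  set DK : Set (BondConfig V) := avoidSet {a, t} {c} with hDK
  set Da : Set (BondConfig V) := avoidSet {a} {t, c} with hDa
  set Dt : Set (BondConfig V) := avoidSet {t} {a, c} with hDt
  set F : Set (BondConfig V) := pocketAugSet {a, t} o (Qa ∪ Qt) with hF
  set FA : Set (BondConfig V) := pocketAugSet {a} o Qa with hFA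
  set FT : Set (BondConfig V) := pocketAugSet {t} o Qt with hFT
  set h5 : Set (BondConfig V) := openConn a t ∩ (openConn a b ∪ openConn t b) with hh5
  set g : Set (BondConfig V) := openConn c b with hg
  set hab : Set (BondConfig V) := openConn a b with hhab
  set htb : Set (BondConfig V) := openConn t b with hhtb
  set g9 : Set (BondConfig V) := openConn t c ∩ openConn t b with hg9
  set g8 : Set (BondConfig V) := openConn a c ∩ openConn a b with hg8
  have memDK : ∀ ω, ω ∈ DK ↔ ¬ (openGraph ω).Reachable a c ∧ ¬ (openGraph ω).Reachable t c := fun ω => by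
    rw [hDK]; exact mem_avoidSet_two_one a t c ω
  have memDa : ∀ ω, ω ∈ Da ↔ ¬ (openGraph ω).Reachable a t ∧ ¬ (openGraph ω).Reachable a c := fun ω => by
    rw [hDa]; exact mem_avoidSet_one_two a t c ω
  have memDt : ∀ ω, ω ∈ Dt ↔ ¬ (openGraph ω).Reachable t a ∧ ¬ (openGraph ω).Reachable t c := fun ω => by
    rw [hDt]; exact mem_avoidSet_one_two t a c ω
  ---------------------------------------------------------------- the six (II)/(II)' bounds and superadditivity
  have hQc : ∀ W ∈ Qa ∪ Qt, Disjoint W ({c} : Set V) := by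
    rintro W (hW | hW)
    · exact Set.disjoint_singleton_right.2 (hQa W hW).2.2
    · exact Set.disjoint_singleton_right.2 (hQt W hW).2.2
  have hQa' : ∀ W ∈ Qa, Disjoint W ({t, c} : Set V) := by
    intro W hW; rw [Set.disjoint_left]; intro x hxW hx
    rcases hx with rfl | hx
    · exact (hQa W hW).2.1 hxW
    · rw [Set.mem_singleton_iff] at hx; subst hx; exact (hQa W hW).2.2 hxW
  have hQt' : ∀ W ∈ Qt, Disjoint W ({a, c} : Set V) := by
    intro W hW; rw [Set.disjoint_left]; intro x hxW hx
    rcases hx with rfl | hx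
    · exact (hQt W hW).1 hxW
    · rw [Set.mem_singleton_iff] at hx; subst hx; exact (hQt W hW).2.2 hxW
  have adm_h5 : ∀ ω ω' : BondConfig V, ω ∈ h5 →
      (⋃ x ∈ ({a, t} : Set V), openEdgeCluster ω x) ⊆ (⋃ x ∈ ({a, t} : Set V), openEdgeCluster ω' x) → ω' ∈ h5 := by
    rw [hh5]
    exact inter_determinedBy_biUnion _ (openConn_determinedBy_biUnion {a, t} (by simp) t)
      (union_determinedBy_biUnion _ (openConn_determinedBy_biUnion {a, t} (by simp) b)
        (openConn_determinedBy_biUnion {a, t} (by simp) b))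
  have adm_g : ∀ ω ω' : BondConfig V, ω ∈ g →
      (⋃ x ∈ ({c} : Set V), openEdgeCluster ω x) ⊆ (⋃ x ∈ ({c} : Set V), openEdgeCluster ω' x) → ω' ∈ g := by
    rw [hg]; exact openConn_determinedBy_biUnion {c} (by simp) b
  have adm_g9 : ∀ ω ω' : BondConfig V, ω ∈ g9 →
      (⋃ x ∈ ({t, c} : Set V), openEdgeCluster ω x) ⊆ (⋃ x ∈ ({t, c} : Set V), openEdgeCluster ω' x) → ω' ∈ g9 := by
    rw [hg9]
    exact inter_determinedBy_biUnion _ (openConn_determinedBy_biUnion {t, c} (by simp) c)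
      (openConn_determinedBy_biUnion {t, c} (by simp) b)
  have adm_g8 : ∀ ω ω' : BondConfig V, ω ∈ g8 →
      (⋃ x ∈ ({a, c} : Set V), openEdgeCluster ω x) ⊆ (⋃ x ∈ ({a, c} : Set V), openEdgeCluster ω' x) → ω' ∈ g8 := by
    rw [hg8]
    exact inter_determinedBy_biUnion _ (openConn_determinedBy_biUnion {a, c} (by simp) c)
      (openConn_determinedBy_biUnion {a, c} (by simp) b)
  have b1 : μ.real (h5 ∩ DK) * μ.real (F ∩ DK) ≤ μ.real DK * μ.real (h5 ∩ (F ∩ DK)) := by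
    have := real_pocketAugSet_inter_ge w ({a, t} : Set V) {c} o (Qa ∪ Qt) hQc h5 adm_h5
    rw [← hμ] at this; exact this
  have b2 : μ.real DK * μ.real (g ∩ (F ∩ DK)) ≤ μ.real (g ∩ DK) * μ.real (F ∩ DK) := by
    have := real_pocketAugSet_sink_le w ({a, t} : Set V) {c} o (Qa ∪ Qt) hQc g adm_g
    rw [← hμ] at this; exact this
  have b3 : μ.real (hab ∩ Da) * μ.real (FA ∩ Da) ≤ μ.real Da * μ.real (hab ∩ (FA ∩ Da)) := by
    have := real_pocketAugSet_openConn_ge w ({a} : Set V) {t, c} a b o (by simp) Qa hQa'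
    rw [← hμ] at this; exact this
  have b4 : μ.real Da * μ.real (g9 ∩ (FA ∩ Da)) ≤ μ.real (g9 ∩ Da) * μ.real (FA ∩ Da) := by
    have := real_pocketAugSet_sink_le w ({a} : Set V) {t, c} o Qa hQa' g9 adm_g9
    rw [← hμ] at this; exact this
  have b5 : μ.real (htb ∩ Dt) * μ.real (FT ∩ Dt) ≤ μ.real Dt * μ.real (htb ∩ (FT ∩ Dt)) := by
    have := real_pocketAugSet_openConn_ge w ({t} : Set V) {a, c} t b o (by simp) Qt hQt'
    rw [← hμ] at this; exact this
  have b6 : μ.real Dt * μ.real (g8 ∩ (FT ∩ Dt)) ≤ μ.real (g8 ∩ Dt) * μ.real (FT ∩ Dt) := by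
    have := real_pocketAugSet_sink_le w ({t} : Set V) {a, c} o Qt hQt' g8 adm_g8
    rw [← hμ] at this; exact this
  have hQa3 : ∀ W ∈ Qa, t ∉ W ∧ c ∉ W := fun W hW => ⟨(hQa W hW).2.1, (hQa W hW).2.2⟩
  have hQt3 : ∀ W ∈ Qt, a ∉ W ∧ c ∉ W := fun W hW => ⟨(hQt W hW).1, (hQt W hW).2.2⟩
  have psa : μ.real (FA ∩ Da) * μ.real Dt * μ.real DK + μ.real (FT ∩ Dt) * μ.real Da * μ.real DK ≤
      μ.real (F ∩ DK) * μ.real Da * μ.real Dt := by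
    have := pocket_superadditive w o a t c Qa Qt hQa3 hQt3 hdis
    rw [← hμ] at this; exact this
  ---------------------------------------------------------------- the four new rows (hub borrowing; sink events {t↔b}, {a↔b})
  have adm_htb_tc : ∀ ω ω' : BondConfig V, ω ∈ htb →
      (⋃ x ∈ ({t, c} : Set V), openEdgeCluster ω x) ⊆ (⋃ x ∈ ({t, c} : Set V), openEdgeCluster ω' x) → ω' ∈ htb := by
    rw [hhtb]; exact openConn_determinedBy_biUnion {t, c} (by simp) b
  have adm_hab_ac : ∀ ω ω' : BondConfig V, ω ∈ hab →
      (⋃ x ∈ ({a, c} : Set V), openEdgeCluster ω x) ⊆ (⋃ x ∈ ({a, c} : Set V), openEdgeCluster ω' x) → ω' ∈ hab := by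
    rw [hhab]; exact openConn_determinedBy_biUnion {a, c} (by simp) b
  have b7 : μ.real (hab ∩ DK) * μ.real (F ∩ DK) ≤ μ.real DK * μ.real (hab ∩ (F ∩ DK)) := by
    have := real_pocketAugSet_openConn_ge w ({a, t} : Set V) {c} a b o (by simp) (Qa ∪ Qt) hQc
    rw [← hμ] at this; exact this
  have b8 : μ.real (htb ∩ DK) * μ.real (F ∩ DK) ≤ μ.real DK * μ.real (htb ∩ (F ∩ DK)) := by
    have := real_pocketAugSet_openConn_ge w ({a, t} : Set V) {c} t b o (by simp) (Qa ∪ Qt) hQc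
    rw [← hμ] at this; exact this
  have b9 : μ.real Da * μ.real (htb ∩ (FA ∩ Da)) ≤ μ.real (htb ∩ Da) * μ.real (FA ∩ Da) := by
    have := real_pocketAugSet_sink_le w ({a} : Set V) {t, c} o Qa hQa' htb adm_htb_tc
    rw [← hμ] at this; exact this
  have b10 : μ.real Dt * μ.real (hab ∩ (FT ∩ Dt)) ≤ μ.real (hab ∩ Dt) * μ.real (FT ∩ Dt) := by
    have := real_pocketAugSet_sink_le w ({t} : Set V) {a, c} o Qt hQt' hab adm_hab_ac
    rw [← hμ] at this; exact this
  ---------------------------------------------------------------- world bookkeeping: W3, W4, W14, W12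
  set W3 : Set (BondConfig V) := hab ∩ (openConn a t)ᶜ ∩ DK with hW3
  set W4 : Set (BondConfig V) := htb ∩ (openConn a t)ᶜ ∩ DK with hW4
  set W14 : Set (BondConfig V) := hab ∩ (openConn a t)ᶜ ∩ openConn t c with hW14
  set W12 : Set (BondConfig V) := htb ∩ (openConn a t)ᶜ ∩ openConn a c with hW12
  have I1 : μ.real (hab ∩ DK) = μ.real W3 + μ.real (h5 ∩ DK) := by
    have := real_ab_DK_split w a t c b; rw [← hμ] at this; exact this
  have I6 : μ.real (htb ∩ DK) = μ.real W4 + μ.real (h5 ∩ DK) := by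
    have := real_tb_DK_split w a t c b; rw [← hμ] at this; exact this
  have I2 : μ.real (hab ∩ Da) = μ.real W3 + μ.real W14 := by
    have := real_ab_Da_split w a t c b; rw [← hμ] at this; exact this
  have I2' : μ.real (htb ∩ Dt) = μ.real W4 + μ.real W12 := by
    have := real_tb_Dt_split w a t c b; rw [← hμ] at this; exact this
  have I5 : μ.real (htb ∩ Da) = μ.real W4 + μ.real (g9 ∩ Da) := by
    have := real_tb_Da_split w a t c b; rw [← hμ] at this; exact this
  have I7 : μ.real (hab ∩ Dt) = μ.real W3 + μ.real (g8 ∩ Dt) := by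
    have := real_ab_Dt_split w a t c b; rw [← hμ] at this; exact this
  -- the two slack inclusions (the differences are the `F_a`-mass of `ab|tc`, the `F_t`-mass of `ac|tb`)
  have S1 : μ.real (hab ∩ (F ∩ DK)) + μ.real (g8 ∩ (FT ∩ Dt)) ≤
      μ.real (h5 ∩ (F ∩ DK)) + μ.real (hab ∩ (FA ∩ Da)) + μ.real (hab ∩ (FT ∩ Dt)) := by
    have := real_slack_a w o b a t c Qa Qt; rw [← hμ] at this; exact this
  have S2 : μ.real (htb ∩ (F ∩ DK)) + μ.real (g9 ∩ (FA ∩ Da)) ≤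
      μ.real (h5 ∩ (F ∩ DK)) + μ.real (htb ∩ (FT ∩ Dt)) + μ.real (htb ∩ (FA ∩ Da)) := by
    have := real_slack_t w o b a t c Qa Qt; rw [← hμ] at this; exact this
  ---------------------------------------------------------------- the arithmetic (MEMO-gen25 §1)
  rw [← hμ] at eL; rw [← hμ] at eR; rw [← hμ] at Ma; rw [← hμ] at Mb; rw [← hμ] at Mc; rw [← hμ] at Md
  rw [eL, eR]
  rw [MKN1, MKN2] at hX
  have Ha' : μ.real (g ∩ DK) + μ.real (g9 ∩ Da) ≤ μ.real (h5 ∩ DK) + μ.real (hab ∩ Da) := by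
    have := hca; rw [Ma, Mb] at this; linarith
  have Ht' : μ.real (g ∩ DK) + μ.real (g8 ∩ Dt) ≤ μ.real (h5 ∩ DK) + μ.real (htb ∩ Dt) := by
    have := hct; rw [Mc, Md] at this; linarith
  have Da_eq : μ.real (openConn a b) - μ.real (openConn c b) =
      μ.real (h5 ∩ DK) + μ.real (hab ∩ Da) - μ.real (g ∩ DK) - μ.real (g9 ∩ Da) := by
    have h1 := Ma; have h2 := Mb; linarith
  have Dt_eq : μ.real (openConn t b) - μ.real (openConn c b) =
      μ.real (h5 ∩ DK) + μ.real (htb ∩ Dt) - μ.real (g ∩ DK) - μ.real (g8 ∩ Dt) := by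
    have h1 := Mc; have h2 := Md; linarith
  rw [Da_eq] at hβ; rw [Dt_eq] at hγ
  -- names
  set dK := μ.real DK with hdK
  set fK := μ.real (F ∩ DK)
  set u5 := μ.real (h5 ∩ (F ∩ DK))
  set q5 := μ.real (h5 ∩ DK)
  set d67 := μ.real (g ∩ (F ∩ DK))
  set q67 := μ.real (g ∩ DK)
  set u35 := μ.real (hab ∩ (F ∩ DK))
  set q35 := μ.real (hab ∩ DK)
  set u45 := μ.real (htb ∩ (F ∩ DK))
  set q45 := μ.real (htb ∩ DK)
  set da := μ.real Da with hda
  set fa := μ.real (FA ∩ Da)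
  set rA := μ.real (hab ∩ (FA ∩ Da))
  set qRa := μ.real (hab ∩ Da)
  set d9 := μ.real (g9 ∩ (FA ∩ Da))
  set q9 := μ.real (g9 ∩ Da)
  set x49 := μ.real (htb ∩ (FA ∩ Da))
  set q49 := μ.real (htb ∩ Da)
  set dt := μ.real Dt with hdt
  set ft := μ.real (FT ∩ Dt)
  set rT := μ.real (htb ∩ (FT ∩ Dt))
  set qRt := μ.real (htb ∩ Dt)
  set d8 := μ.real (g8 ∩ (FT ∩ Dt))
  set q8 := μ.real (g8 ∩ Dt)
  set x38 := μ.real (hab ∩ (FT ∩ Dt))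
  set q38 := μ.real (hab ∩ Dt)
  set Q3 := μ.real W3
  set Q4 := μ.real W4
  set Q14 := μ.real W14
  set Q12 := μ.real W12
  have h0dK : 0 ≤ dK := measureReal_nonneg
  have h0da : 0 ≤ da := measureReal_nonneg
  have h0dt : 0 ≤ dt := measureReal_nonneg
  have h0fK : 0 ≤ fK := measureReal_nonneg
  have h0fa : 0 ≤ fa := measureReal_nonneg
  have h0ft : 0 ≤ ft := measureReal_nonneg
  have h0rA : 0 ≤ rA := measureReal_nonneg
  have h0rT : 0 ≤ rT := measureReal_nonneg
  have h0u5 : 0 ≤ u5 := measureReal_nonneg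
  have h0u35 : 0 ≤ u35 := measureReal_nonneg
  have h0u45 : 0 ≤ u45 := measureReal_nonneg
  have h0x49 : 0 ≤ x49 := measureReal_nonneg
  have h0x38 : 0 ≤ x38 := measureReal_nonneg
  have h0Q3 : 0 ≤ Q3 := measureReal_nonneg
  have h0Q4 : 0 ≤ Q4 := measureReal_nonneg
  have hu5 : u5 ≤ dK := measureReal_mono (inter_subset_right.trans inter_subset_right)
  have hd67 : d67 ≤ dK := measureReal_mono (inter_subset_right.trans inter_subset_right)
  have hu35 : u35 ≤ dK := measureReal_mono (inter_subset_right.trans inter_subset_right)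
  have hu45 : u45 ≤ dK := measureReal_mono (inter_subset_right.trans inter_subset_right)
  have hq5 : q5 ≤ dK := measureReal_mono inter_subset_right
  have hq67 : q67 ≤ dK := measureReal_mono inter_subset_right
  have hQ3 : Q3 ≤ dK := measureReal_mono inter_subset_right
  have hQ4 : Q4 ≤ dK := measureReal_mono inter_subset_right
  have hrA : rA ≤ da := measureReal_mono (inter_subset_right.trans inter_subset_right)
  have hd9 : d9 ≤ da := measureReal_mono (inter_subset_right.trans inter_subset_right)
  have hx49 : x49 ≤ da := measureReal_mono (inter_subset_right.trans inter_subset_right)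
  have hrT : rT ≤ dt := measureReal_mono (inter_subset_right.trans inter_subset_right)
  have hd8 : d8 ≤ dt := measureReal_mono (inter_subset_right.trans inter_subset_right)
  have hx38 : x38 ≤ dt := measureReal_mono (inter_subset_right.trans inter_subset_right)
  have h0d67 : 0 ≤ d67 := measureReal_nonneg
  have h0d9 : 0 ≤ d9 := measureReal_nonneg
  have h0d8 : 0 ≤ d8 := measureReal_nonneg
  have h0q5 : 0 ≤ q5 := measureReal_nonneg
  have h0q67 : 0 ≤ q67 := measureReal_nonneg
  have hβ' : β * Q14 ≤ q5 + qRa - q67 - q9 := by linarith [hβ]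
  have hγ' : γ * Q12 ≤ q5 + qRt - q67 - q8 := by linarith [hγ]
  have hs0 : 0 ≤ β * Q3 + γ * Q4 - (q67 - q5) := by linarith [hX]
  -- Harris for the degenerate cases: `da = 0` or `dt = 0` forces both (given `dK > 0`)
  have hDa_eq : Da = (openConn a t)ᶜ ∩ (openConn a c)ᶜ := by
    ext ω; simp only [memDa, Set.mem_inter_iff, Set.mem_compl_iff, openConn, Set.mem_setOf_eq]
  have hDt_eq : Dt = (openConn t a)ᶜ ∩ (openConn t c)ᶜ := by
    ext ω; simp only [memDt, Set.mem_inter_iff, Set.mem_compl_iff, openConn, Set.mem_setOf_eq]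
  have harris_a : μ.real ((openConn a t)ᶜ) * μ.real ((openConn a c)ᶜ) ≤ da := by
    have h := prodBernoulli_harris_lower w (isUpperSet_openConn a t).compl (isUpperSet_openConn a c).compl
      (hmeas _) (hmeas _)
    rw [← hμ] at h; rw [hda, hDa_eq]; exact h
  have harris_t : μ.real ((openConn t a)ᶜ) * μ.real ((openConn t c)ᶜ) ≤ dt := by
    have h := prodBernoulli_harris_lower w (isUpperSet_openConn t a).compl (isUpperSet_openConn t c).compl
      (hmeas _) (hmeas _)
    rw [← hμ] at h; rw [hdt, hDt_eq]; exact h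
  have hdK_le_ac : dK ≤ μ.real ((openConn a c : Set (BondConfig V))ᶜ) :=
    measureReal_mono (fun ω hω => by
      rw [memDK] at hω; simpa only [Set.mem_compl_iff, openConn, Set.mem_setOf_eq] using hω.1)
  have hdK_le_tc : dK ≤ μ.real ((openConn t c : Set (BondConfig V))ᶜ) :=
    measureReal_mono (fun ω hω => by
      rw [memDK] at hω; simpa only [Set.mem_compl_iff, openConn, Set.mem_setOf_eq] using hω.2)
  have hdt_le_ta : dt ≤ μ.real ((openConn a t : Set (BondConfig V))ᶜ) :=
    measureReal_mono (fun ω hω => by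
      rw [memDt] at hω
      simp only [Set.mem_compl_iff, openConn, Set.mem_setOf_eq]
      exact fun h => hω.1 h.symm)
  have hda_le_at : da ≤ μ.real ((openConn t a : Set (BondConfig V))ᶜ) :=
    measureReal_mono (fun ω hω => by
      rw [memDa] at hω
      simp only [Set.mem_compl_iff, openConn, Set.mem_setOf_eq]
      exact fun h => hω.1 h.symm)
  have hdeg : dK = 0 ∨ (0 < dK ∧ 0 < da ∧ 0 < dt) ∨ (0 < dK ∧ da = 0 ∧ dt = 0) := by
    by_cases hK0 : dK = 0
    · exact Or.inl hK0
    · have hKpos : 0 < dK := lt_of_le_of_ne h0dK (Ne.symm hK0)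
      by_cases hmain : 0 < da ∧ 0 < dt
      · exact Or.inr (Or.inl ⟨hKpos, hmain⟩)
      · right; right
        refine ⟨hKpos, ?_⟩
        by_cases ha0 : da = 0
        · refine ⟨ha0, ?_⟩
          have h1 : μ.real ((openConn a t)ᶜ) * μ.real ((openConn a c)ᶜ) = 0 :=
            le_antisymm (ha0 ▸ harris_a) (mul_nonneg measureReal_nonneg measureReal_nonneg)
          rcases mul_eq_zero.1 h1 with h | h
          · exact le_antisymm (h ▸ hdt_le_ta) h0dt
          · exact absurd (le_antisymm (h ▸ hdK_le_ac) h0dK) hK0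
        · have ht0 : dt = 0 := by
            by_contra ht0
            exact hmain ⟨lt_of_le_of_ne h0da (Ne.symm ha0), lt_of_le_of_ne h0dt (Ne.symm ht0)⟩
          refine ⟨?_, ht0⟩
          have h1 : μ.real ((openConn t a)ᶜ) * μ.real ((openConn t c)ᶜ) = 0 :=
            le_antisymm (ht0 ▸ harris_t) (mul_nonneg measureReal_nonneg measureReal_nonneg)
          rcases mul_eq_zero.1 h1 with h | h
          · exact le_antisymm (h ▸ hda_le_at) h0da
          · exact absurd (le_antisymm (h ▸ hdK_le_tc) h0dK) hK0
  exact borrow_arith β γ dK fK u5 q5 d67 q67 u35 q35 u45 q45 Q3 Q4 da fa rA qRa d9 q9 x49 q49 Q14 dt ft rT qRt d8 q8 x38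
    q38 Q12 hβ0 hγ0 hβγ h0dK h0da h0dt h0fK h0fa h0ft h0rA h0rT h0u5 h0u35 h0u45 h0x49 h0x38 h0Q3 h0Q4 h0d67 h0d9 h0d8 h0q5
    h0q67 hu5 hd67 hu35 hu45 hq5 hq67 hQ3 hQ4 hrA hd9 hx49 hrT hd8 hx38 b1 b2 b7 b8 b3 b4 b9 b5 b6 b10 psa I1 I6 I2 I2' I5
    I7 hβ' hγ' hs0 S1 S2 hdeg

end KNGoodThreeKN

end Summit.CriticalPhenomena.PercolationContinuityZ3.Theorems
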